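import Summits.ValiantsHypothesis.ValiantsHypothesis.Theorems.DefinabilityGapK2cPFamilyRung
import Summits.ValiantsHypothesis.ValiantsHypothesis.Theorems.DefinabilityGapWeakToK1ws
import Literature.Barriers.ValiantsHypothesis.CT23Thm31Holds
import Literature.Barriers.ValiantsHypothesis.CT23ProjCircuitInputNormalisation
import Literature.Computability.AlgebraicComplexity.VNPClosedUnderComposition
import Literature.Computability.AlgebraicComplexity.ValiantConjectureProofs
import Literature.Computability.AlgebraicComplexity.ArithCircuitProofs

/-!
# DefinabilityGap — K2c rung 3: `VPSPACE`-grade annihilators of the planted Kabanets–Impagliazzo map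
# (Chatterjee–Tengse Thm. 3.1, the tree's theorem `CT23_thm_3_1_holds`, instantiated)

Route `DefinabilityGap` (`Theses/DefinabilityGap.lean`), crux K2c `KIAnnihilatorDefinableOnCollapse`
(`stmt-ValiantsHypothesis-23546`): under `VP = VNP` the planted map `G_m` (the permanent `per_m` read on the
`q(m)³` quadratic-curve blocks of the `q × q` grid, `q = q(m)` the least prime `≥ m² + 1`; in the tree
`kiPer m`) has a `VNP` family of annihilators. Rungs so far (same seat): a p-family of annihilators
(`DefinabilityGapK2cPFamilyRung.k2c_pFamily_rung`, dimension count) and an INTEGER p-family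
(`DefinabilityGapK2cIntegralRung.k2c_integral_rung`). THIS FILE, rung 3, UNCONDITIONAL: a p-family of
annihilators computed by fan-in-two circuits WITH PROJECTION GATES of p-bounded size over p-boundedly many
bound workspace variables (Chatterjee–Tengse's `VPSPACE_b` up to the extraction of constants, Def. 2.22) —
i.e. the annihilators are as definable as `VPSPACE`; what K2c's collapse hypothesis must still do is lift them
into `VNP = VP` (kit SPLIT-KIT-v2 §3B of the decomposition workshop: the residual `CollapseLiftsToVPSPACE`).

## Proof

* **Encoder** (`aeval_indicator_encoder`, `encoder_family`): `U_m(y, w) := per_m(M)` with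
  `M_{ab} := Σ_{p ∈ q×q} w_{(ι(a,b), p)} · y_p` (`ι = permPad`: the cell index in `Fin q`); at the indicator
  `w_{(i,p)} := [p = S_c(i)]` of the block `S_c` it specialises to `per_m(y|S_c) = kiPer m c`, for ANY block
  design — so `U_m` ENCODES `G_m` (Def. 1.7, `Encodes`). `U_m ∈ VNP_ℂ` (`isVNPFamily_perPoly_holds` composed with
  the `m²` bilinear forms of complexity `≤ 2q²`, `IsVNPFamily.aeval`), hence — Valiant's Boolean sum gate by
  gate (`ProjCircuit.boolSumCircuit`, as in `isVPSPACE0Family_of_isVNP0Family`) — `rename Sum.inl U_m` is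
  computed by a fan-in-two projection circuit of p-bounded size `s(m)` whose bound workspace is the sum bits.
* **Engine**: `CT23_thm_3_1_holds ℂ` with `(m, n, d, s) := (q², q³, m, s(m))` (`2q² ≤ q³` since `q ≥ 2`,
  `deg G_c ≤ m`, `m ≥ max m₀ 1`) gives `A ≠ 0` of individual degree `≤ 3q²m` with `A ∘ G = 0` and a
  projection circuit of size and workspace `≤ (q²·m·s(m))^c`; transported from `Fin (q³)` to `Fin 3 → Fin q`
  (`ProjCircuit.renameCircuit` along the equivalence, `degreeOf_rename_of_injective`); the zero polynomial
  with a gate-free circuit below the threshold. p-family: `deg A ≤ q³ · 3q²m`.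

Honest framing: a CONSEQUENCE-side rung (no hypothesis at all), strictly below K2c (which asks `VNP` under the
collapse); it is NOT a lower bound and `VP ≠ VNP` is NOT proved.

## References

* [ChatterjeeTengse2023] P. Chatterjee, A. Tengse, *Lower Bounds from Succinct Hitting Sets*, arXiv:2309.07612v2,
  Def. 1.7, Thm. 3.1, Thm. 4.1 (the tree's `CT23_thm_3_1_holds`, val-lit X-CT23 engine).
* [KabanetsImpagliazzo2003] V. Kabanets, R. Impagliazzo, *Derandomizing polynomial identity tests means proving
  circuit lower bounds*, STOC 2003, Thm. 7.7 (the generator).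
* [Burgisser2024Completeness] P. Bürgisser, completeness survey, §3.1 (`VNP` closed under composition; the tree's
  `IsVNPFamily.aeval`).
-/

noncomputable section

open MvPolynomial
open Literature.Computability.AlgebraicComplexity
open Literature.Barriers.ValiantsHypothesis
open Summit.ValiantsHypothesis.ValiantsHypothesis.Theorems.DefinabilityGapAffineRung (qOf qOf_spec sq_le_qOf quadDesign kiPer)
open Summit.ValiantsHypothesis.ValiantsHypothesis.Theorems.DefinabilityGapK2cPFamilyRung (isPBounded_qOf_pow totalDegree_le_card_mul_of_degreeOf_le)
open Summit.ValiantsHypothesis.ValiantsHypothesis.Theorems.DefinabilityGapWeakToK1ws (isPBounded_qOf)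

namespace Summit.ValiantsHypothesis.ValiantsHypothesis.Theorems.DefinabilityGapK2cProjRung

/-- Selection by an indicator: `Σ_p [p = p₀] · v p = v p₀`. [folklore] -/
theorem sum_ite_eq_mul {κ R : Type*} [Fintype κ] [DecidableEq κ] [CommSemiring R] (p₀ : κ) (v : κ → R) :
    ∑ p, (if p = p₀ then (1 : R) else 0) * v p = v p₀ := by
  simp [ite_mul, Finset.sum_ite_eq']

/-- The complexity of a selection form `Σ_p X(w p) · X(y p)` is at most `2·#κ`. [cite: Burgisser2000, §2.1] -/
theorem complexity_selectionForm_le {κ σ : Type*} [Fintype κ] (w y : κ → σ) :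
    complexity (∑ p, X (w p) * X (y p) : MvPolynomial σ ℂ) ≤ 2 * Fintype.card κ := by
  refine (complexity_finset_sum_le _ _).trans ?_
  have h : ∀ p : κ, complexity (X (w p) * X (y p) : MvPolynomial σ ℂ) ≤ 1 := fun p =>
    (complexity_mul_le_holds _ _).trans (by rw [complexity_X_holds, complexity_X_holds])
  calc ∑ p, complexity (X (w p) * X (y p) : MvPolynomial σ ℂ) + (Finset.univ : Finset κ).card
      ≤ ∑ _p : κ, 1 + (Finset.univ : Finset κ).card := by
        gcongr with p _
        exact h p
    _ = 2 * Fintype.card κ := by simp [Finset.card_univ]; ring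

/-- The total degree of a selection form is at most `2`. [folklore] -/
theorem totalDegree_selectionForm_le {κ σ : Type*} [Fintype κ] (w y : κ → σ) :
    (∑ p, X (w p) * X (y p) : MvPolynomial σ ℂ).totalDegree ≤ 2 := by
  refine (totalDegree_finsetSum _ _).trans (Finset.sup_le fun p _ => ?_)
  exact (totalDegree_mul _ _).trans (by rw [totalDegree_X, totalDegree_X])

/-- **The encoder.** `U(y, w) := per_m( Σ_p w_{(ι(a,b), p)} · y_p )_{a,b}` specialises, at the indicator
`w_{(i, p)} := [p = S_c(i)]` of a block `S_c`, to `per_m(y|S_c)` — for ANY block design `S`.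
[cite: ChatterjeeTengse2023, Def. 1.7] -/
theorem aeval_indicator_encoder {m q r : ℕ} (ι : Fin m × Fin m ↪ Fin q) (S : Fin q ↪ Fin q × Fin q)
    (eY : Fin q × Fin q ≃ Fin (q * q)) (eW : Fin q × (Fin q × Fin q) ≃ Fin r) :
    aeval (Sum.elim X fun j : Fin r => C (if (eW.symm j).2 = S (eW.symm j).1 then (1 : ℂ) else 0))
        (aeval (fun ab : Fin m × Fin m =>
          ∑ p : Fin q × Fin q, (X (Sum.inr (eW (ι ab, p))) : MvPolynomial (Fin (q * q) ⊕ Fin r) ℂ) *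
            X (Sum.inl (eY p))) (perPoly (Fin m) ℂ)) =
      rename eY (rename S (rename ι (perPoly (Fin m) ℂ))) := by
  rw [← AlgHom.comp_apply, comp_aeval, rename_rename, rename_rename]
  have hfun : (fun ab : Fin m × Fin m => aeval
      (Sum.elim X fun j : Fin r => C (if (eW.symm j).2 = S (eW.symm j).1 then (1 : ℂ) else 0))
      (∑ p : Fin q × Fin q, (X (Sum.inr (eW (ι ab, p))) : MvPolynomial (Fin (q * q) ⊕ Fin r) ℂ) *
        X (Sum.inl (eY p)))) = fun ab => X (eY (S (ι ab))) := by
    funext ab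
    simp only [map_sum, map_mul, aeval_X, Sum.elim_inr, Sum.elim_inl, Equiv.symm_apply_apply]
    rw [show (fun p : Fin q × Fin q => C (if p = S (ι ab) then (1 : ℂ) else 0) *
        (X (eY p) : MvPolynomial (Fin (q * q)) ℂ)) =
        fun p => (if p = S (ι ab) then (1 : MvPolynomial (Fin (q * q)) ℂ) else 0) * X (eY p) from
      funext fun p => by split_ifs <;> simp]
    exact sum_ite_eq_mul (S (ι ab)) fun p => (X (eY p) : MvPolynomial (Fin (q * q)) ℂ)
  rw [hfun]
  exact DFunLike.congr_fun (MvPolynomial.algHom_ext (fun i => by simp) :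
    (aeval fun ab => X (eY (S (ι ab))) : MvPolynomial (Fin m × Fin m) ℂ →ₐ[ℂ] MvPolynomial (Fin (q * q)) ℂ) =
      rename ((⇑eY ∘ ⇑S) ∘ ⇑ι)) _

/-- **The encoder family for the planted KI map, with its projection circuits.** For every `m` (with
`q = q(m)`): the polynomial `U_m(y, w) := per_m( Σ_p w_{(ι(a,b),p)} · y_p )_{a,b}` in the `q²` seed variables
`y` (indexed through `Fin q × Fin q ≃ Fin (q·q)`) and `q³` encoding variables `w`, is in `VNP_ℂ` (the
permanent composed with bilinear forms, `IsVNPFamily.aeval`), hence computed — as `rename Sum.inl U_m` over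
the Boolean-sum bits as bound workspace — by fan-in-two circuits with projection gates of p-bounded size
(Valiant's sum gate by gate, `boolSumCircuit`); and `U_m` ENCODES the planted generator: at the indicator of
the block `S_c` it specialises to `per_m(y|S_c) = kiPer m c`.
[cite: ChatterjeeTengse2023, Def. 1.7 and §2.2 (VNP ⊆ VPSPACE); Burgisser2024Completeness, §3.1] -/
theorem encoder_family :
    ∃ (s w : ℕ → ℕ)
      (U : ∀ m, MvPolynomial (Fin (qOf m * qOf m) ⊕ Fin (qOf m * (qOf m * qOf m))) ℂ)
      (Q : ∀ m, ProjCircuit ℂ ((Fin (qOf m * qOf m) ⊕ Fin (qOf m * (qOf m * qOf m))) ⊕ Fin (w m))),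
      IsPBounded s ∧
        (∀ m, (Q m).IsFanInTwo ∧ (Q m).Computes (rename Sum.inl (U m)) ∧ (Q m).size + 2 ≤ s m) ∧
        ∀ m (c : Fin 3 → Fin (qOf m)), ∃ a : Fin (qOf m * (qOf m * qOf m)) → ℂ,
          aeval (Sum.elim X fun j => C (a j)) (U m) = rename finProdFinEquiv (kiPer m c) := by
  classical
  -- indexing of the encoding variables `w_{(i, p)}`, `i ∈ Fin q`, `p ∈ Fin q × Fin q`
  have heW : ∀ m, ∃ _e : Fin (qOf m) × (Fin (qOf m) × Fin (qOf m)) ≃ Fin (qOf m * (qOf m * qOf m)), True :=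
    fun m => ⟨(Equiv.prodCongr (Equiv.refl _) finProdFinEquiv).trans finProdFinEquiv, trivial⟩
  choose eW _ using heW
  -- the bilinear selection forms substituted for the entries of `per_m`
  obtain ⟨θ, hθ⟩ : ∃ θ : ∀ m, Fin m × Fin m →
      MvPolynomial (Fin (qOf m * qOf m) ⊕ Fin (qOf m * (qOf m * qOf m))) ℂ,
      ∀ m ab, θ m ab = ∑ p : Fin (qOf m) × Fin (qOf m),
        X (Sum.inr (eW m (permPad (sq_le_qOf m) ab, p))) * X (Sum.inl (finProdFinEquiv p)) :=
    ⟨_, fun _ _ => rfl⟩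
  have hU : IsVNPFamily fun m => aeval (θ m) (perPoly (Fin m) ℂ) := by
    refine (isVNPFamily_perPoly_holds ℂ).aeval θ ?_ ?_ ?_
    · refine IsPBounded.mono (t := fun m => qOf m * qOf m + qOf m * (qOf m * qOf m))
        (IsPBounded.add_holds (IsPBounded.mul_holds isPBounded_qOf isPBounded_qOf)
          (IsPBounded.mul_holds isPBounded_qOf (IsPBounded.mul_holds isPBounded_qOf isPBounded_qOf)))
        fun m => ?_
      simp [Fintype.card_sum, Fintype.card_fin]
    · refine IsPBounded.mono (t := fun _ => 2) (IsPBounded.const 2) fun m => Finset.sup_le fun ab _ => ?_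
      rw [hθ]
      exact totalDegree_selectionForm_le _ _
    · refine IsPBounded.mono (t := fun m => m * m * (2 * (qOf m * qOf m)))
        (IsPBounded.mul_holds (IsPBounded.mul_holds IsPBounded.id IsPBounded.id)
          (IsPBounded.mul_holds (IsPBounded.const 2) (IsPBounded.mul_holds isPBounded_qOf isPBounded_qOf)))
        fun m => ?_
      calc ∑ ab, complexity (θ m ab) ≤ ∑ _ab : Fin m × Fin m, 2 * (qOf m * qOf m) := by
            refine Finset.sum_le_sum fun ab _ => ?_
            rw [hθ]
            refine (complexity_selectionForm_le _ _).trans (le_of_eq ?_)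
            simp [Fintype.card_prod, Fintype.card_fin]
        _ = m * m * (2 * (qOf m * qOf m)) := by simp [Finset.card_univ, Fintype.card_prod, Fintype.card_fin]
  obtain ⟨-, u, g, hg, hUg⟩ := hU
  have hu : IsPBounded u := hg.1.1.mono fun n => by simp [Fintype.card_sum]
  have hP : ∀ m, ∃ P : ArithCircuit ℂ
      ((Fin (qOf m * qOf m) ⊕ Fin (qOf m * (qOf m * qOf m))) ⊕ Fin (u m)),
      P.IsFanInTwo ∧ P.Computes (g m) ∧ P.size = complexity (g m) :=
    fun m => ArithCircuit.exists_computes_size_eq_complexity (g m)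
  choose P hP1 hP2 hP3 using hP
  refine ⟨fun m => complexity (g m) + 3 * u m + 2, u, fun m => aeval (θ m) (perPoly (Fin m) ℂ),
    fun m => (ProjCircuit.ofArithCircuit (P m)).boolSumCircuit (u m), ?_, fun m => ⟨?_, ?_, ?_⟩,
    fun m c => ?_⟩
  · exact IsPBounded.add_holds (IsPBounded.add_holds hg.2
      (IsPBounded.mul_holds (IsPBounded.const 3) hu)) (IsPBounded.const 2)
  · exact ProjCircuit.isFanInTwo_boolSumCircuit (ProjCircuit.isFanInTwo_ofArithCircuit (hP1 m)) _
  · rw [ProjCircuit.Computes, ProjCircuit.eval_boolSumCircuit _ le_rfl, ProjCircuit.eval_ofArithCircuit,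
      partialBoolSum_eq_rename_boolSum, show (P m).eval = g m from hP2 m, ← hUg m]
  · rw [ProjCircuit.size_boolSumCircuit _ le_rfl, ProjCircuit.size_ofArithCircuit, hP3 m]
  · refine ⟨fun j => if ((eW m).symm j).2 = quadDesign m c ((eW m).symm j).1 then 1 else 0, ?_⟩
    beta_reduce
    have hθm : θ m = fun ab => ∑ p : Fin (qOf m) × Fin (qOf m),
        X (Sum.inr (eW m (permPad (sq_le_qOf m) ab, p))) * X (Sum.inl (finProdFinEquiv p)) :=
      funext (hθ m)
    rw [hθm, aeval_indicator_encoder (permPad (sq_le_qOf m)) (quadDesign m c) finProdFinEquiv (eW m)]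
    rfl

/-- **K2c rung 3 (`VPSPACE`-grade annihilators of the planted map; Chatterjee–Tengse Thm. 3.1 instantiated).**
There are a p-family `A = (A_m)_m` over `ℂ` in the `q(m)³` output variables of the planted
Kabanets–Impagliazzo map `G_m` (the permanent `per_m` read on the `q³` quadratic-curve blocks of the
`q × q` grid, `kiPer m`), a p-bounded `t` and fan-in-two circuits WITH PROJECTION GATES `Cq_m` of p-bounded
size over `t(m)` bound workspace variables computing `A_m` (as `rename Sum.inl A_m`), such that for all large
`m`, `A_m ≠ 0` and `A_m ∘ G_m = 0`. Proof: the encoder family (`encoder_family`: `U_m ∈ VNP_ℂ` encodes `G_m`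
with circuits of p-bounded size `s(m)`), then `CT23_thm_3_1_holds ℂ` with `(m, n, d, s) := (q², q³, m, s(m))`
(`2q² ≤ q³` as `q ≥ 2`; individual degree `≤ 3q²m`, circuit size and workspace `≤ (q²·m·s)^c`), transported
from `Fin (q³)` to `Fin 3 → Fin q` (`renameCircuit` along the equivalence). This is the third rung under crux
K2c `KIAnnihilatorDefinableOnCollapse` (whose conclusion asks `A ∈ VNP` under `VP = VNP`): unconditionally
the annihilators are as definable as `VPSPACE` (projection circuits), the class in which K2c's collapse
hypothesis must lift them to `VNP = VP`. Not a lower bound; `VP ≠ VNP` is NOT proved.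
[cite: ChatterjeeTengse2023, Thm. 3.1 and Thm. 4.1; KabanetsImpagliazzo2003, Thm. 7.7] -/
theorem k2c_proj_rung :
    ∃ (A : ∀ m : ℕ, MvPolynomial (Fin 3 → Fin (qOf m)) ℂ) (t : ℕ → ℕ)
      (Cq : ∀ m, ProjCircuit ℂ ((Fin 3 → Fin (qOf m)) ⊕ Fin (t m))),
      IsPFamily A ∧ IsPBounded t ∧
        (∀ m, (Cq m).IsFanInTwo ∧ (Cq m).Computes (rename Sum.inl (A m))) ∧
        IsPBounded (fun m => (Cq m).size) ∧
        ∃ m₁, ∀ m, m₁ ≤ m → A m ≠ 0 ∧ bind₁ (kiPer m) (A m) = 0 := by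
  classical
  obtain ⟨s, w, U, Q, hs, hQ, henc⟩ := encoder_family
  obtain ⟨c, m₀, h31⟩ := CT23_thm_3_1_holds ℂ
  have he : ∀ m, ∃ _e : (Fin 3 → Fin (qOf m)) ≃ Fin (qOf m ^ 3), True :=
    fun m => ⟨Fintype.equivFinOfCardEq (by simp [Fintype.card_fin]), trivial⟩
  choose e₃ _ using he
  have key : ∀ m, ∃ (t : ℕ) (A : MvPolynomial (Fin 3 → Fin (qOf m)) ℂ)
      (Cq : ProjCircuit ℂ ((Fin 3 → Fin (qOf m)) ⊕ Fin t)),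
      Cq.IsFanInTwo ∧ Cq.Computes (rename Sum.inl A) ∧ t ≤ (qOf m * qOf m * m * s m) ^ c ∧
        Cq.size ≤ (qOf m * qOf m * m * s m) ^ c ∧ (∀ j, A.degreeOf j ≤ 3 * (qOf m * qOf m) * m) ∧
        (max m₀ 1 ≤ m → A ≠ 0 ∧ bind₁ (kiPer m) A = 0) := by
    intro m
    by_cases hm : max m₀ 1 ≤ m
    · have hm₀ : m₀ ≤ m := le_of_max_le_left hm
      have hm1 : 1 ≤ m := le_of_max_le_right hm
      have hq : m * m + 1 ≤ qOf m := (qOf_spec m).1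
      have hq2 : 2 ≤ qOf m := by nlinarith
      have hmq : m₀ ≤ qOf m * qOf m := by nlinarith
      have h2q : 2 * (qOf m * qOf m) ≤ qOf m ^ 3 := by
        calc 2 * (qOf m * qOf m) ≤ qOf m * (qOf m * qOf m) := Nat.mul_le_mul_right _ hq2
          _ = qOf m ^ 3 := by ring
      obtain ⟨G', hG'⟩ : ∃ G' : Fin (qOf m ^ 3) → MvPolynomial (Fin (qOf m * qOf m)) ℂ,
          ∀ i, G' i = rename finProdFinEquiv (kiPer m ((e₃ m).symm i)) := ⟨_, fun _ => rfl⟩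
      have hGdeg : ∀ i, (G' i).totalDegree ≤ m := fun i => by
        rw [hG']
        exact (totalDegree_rename_le _ _).trans
          ((totalDegree_rename_le _ _).trans (totalDegree_perPad_le _))
      have hGenc : Encodes (U m) G' := (encodes_iff _ _).2 fun i => by
        obtain ⟨a, ha⟩ := henc m ((e₃ m).symm i)
        exact ⟨a, by rw [ha, hG']⟩
      have hs2 : 2 ≤ s m := by have := (hQ m).2.2; omega
      have hQs : (Q m).size ≤ s m := by have := (hQ m).2.2; omega
      obtain ⟨t, A, Q', hA0, hAdeg, hann, hfan, hcomp, ht, hsize⟩ :=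
        h31 (qOf m * qOf m) (qOf m ^ 3) m (s m) (qOf m * (qOf m * qOf m)) (w m) G' (U m) (Q m)
          hmq h2q hm1 hs2 hGdeg (hQ m).1 (hQ m).2.1 hQs hGenc
      have hinj : Function.Injective (Sum.map (e₃ m).symm (id : Fin t → Fin t)) :=
        Sum.map_injective.2 ⟨(e₃ m).symm.injective, Function.injective_id⟩
      refine ⟨t, rename (e₃ m).symm A, Q'.renameCircuit (Sum.map (e₃ m).symm id),
        ProjCircuit.isFanInTwo_renameCircuit hfan _, ?_, ht, by rwa [ProjCircuit.size_renameCircuit],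
        fun j => ?_, fun _ => ⟨fun h0 => hA0 ?_, ?_⟩⟩
      · rw [ProjCircuit.Computes, ProjCircuit.eval_renameCircuit _ hinj, show Q'.eval = _ from hcomp,
          rename_rename, rename_rename]
        rfl
      · have hj : j = (e₃ m).symm (e₃ m j) := ((e₃ m).symm_apply_apply j).symm
        rw [hj, degreeOf_rename_of_injective (e₃ m).symm.injective]
        exact hAdeg _
      · exact rename_injective _ (e₃ m).symm.injective (by rw [h0, map_zero])
      · have h1 : aeval G' A = rename finProdFinEquiv (aeval (fun i => kiPer m ((e₃ m).symm i)) A) := by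
          rw [← AlgHom.comp_apply, comp_aeval]
          exact congrArg (fun F => aeval F A) (funext hG')
        have h2 : aeval (fun i => kiPer m ((e₃ m).symm i)) A = 0 :=
          rename_injective _ finProdFinEquiv.injective (by rw [← h1, hann, map_zero])
        rw [bind₁_rename]
        exact h2
    · obtain ⟨P₀, hP1, hP2, hP3⟩ := ArithCircuit.exists_computes_size_eq_complexity
        (0 : MvPolynomial ((Fin 3 → Fin (qOf m)) ⊕ Fin 0) ℂ)
      refine ⟨0, 0, ProjCircuit.ofArithCircuit P₀, ProjCircuit.isFanInTwo_ofArithCircuit hP1, ?_,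
        Nat.zero_le _, ?_, fun j => by rw [degreeOf_zero]; exact Nat.zero_le _, fun h => absurd h hm⟩
      · rw [ProjCircuit.Computes, ProjCircuit.eval_ofArithCircuit, show P₀.eval = 0 from hP2, map_zero]
      · rw [ProjCircuit.size_ofArithCircuit, hP3, ← C_0, complexity_C_holds]
        exact Nat.zero_le _
  choose t A Cq hfan hcomp ht hsize hdeg hgood using key
  have hB : IsPBounded fun m => (qOf m * qOf m * m * s m) ^ c :=
    IsPBounded.pow_holds (IsPBounded.mul_holds
      (IsPBounded.mul_holds (IsPBounded.mul_holds isPBounded_qOf isPBounded_qOf) IsPBounded.id) hs) c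
  refine ⟨A, t, Cq, ⟨?_, ?_⟩, hB.mono ht, fun m => ⟨hfan m, hcomp m⟩, hB.mono hsize, max m₀ 1,
    fun m hm => hgood m hm⟩
  · exact (isPBounded_qOf_pow 3).mono fun m => by simp [Fintype.card_fin]
  · refine IsPBounded.mono (t := fun m => qOf m ^ 3 * (3 * (qOf m * qOf m) * m))
      (IsPBounded.mul_holds (isPBounded_qOf_pow 3) (IsPBounded.mul_holds
        (IsPBounded.mul_holds (IsPBounded.const 3) (IsPBounded.mul_holds isPBounded_qOf isPBounded_qOf))
        IsPBounded.id)) fun m => ?_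
    exact (totalDegree_le_card_mul_of_degreeOf_le (hdeg m)).trans (le_of_eq (by simp [Fintype.card_fin]))

end Summit.ValiantsHypothesis.ValiantsHypothesis.Theorems.DefinabilityGapK2cProjRung

end
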